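import Mathlib

/-!
# `FidelityWitnesses.RankTwoAdditivity` (stmt-MatrixMultiplication-4964) — 2×2 matrix toolkit

Entrywise facts for positive semidefinite complex 2×2 matrices and the inequalities used in the balanced case
of the key lemma for the core inequality: `Re tr(AB) ≥ 0` for `A, B ⪰ 0`, monotonicity of `det` on the PSD
cone, Hölder's inequality for the 2×2 fidelity `tr(AB) + 2√(det A det B) ≤ tr(AP) tr(B adj P)/det P`
(stated multiplied out, with `P = E Eᴴ`).  Supports item `stmt-MatrixMultiplication-4964`; no definitions are introduced.
-/

namespace Summit.MatrixMultiplication.MatrixMultiplication.Theorems.RankTwoAdditivity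

open scoped BigOperators ComplexConjugate ComplexOrder Matrix

/-- Entrywise description of a positive semidefinite complex 2×2 matrix: real nonnegative diagonal,
conjugate off-diagonal entries, and `|A₀₁|² ≤ A₀₀ A₁₁`. -/
theorem psd_fin_two_entries (A : Matrix (Fin 2) (Fin 2) ℂ) (hA : A.PosSemidef) :
    0 ≤ (A 0 0).re ∧ 0 ≤ (A 1 1).re ∧ (A 0 0).im = 0 ∧ (A 1 1).im = 0 ∧ A 1 0 = conj (A 0 1)
      ∧ ‖A 0 1‖ ^ 2 ≤ (A 0 0).re * (A 1 1).re := by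
  have h00 := Complex.nonneg_iff.1 (hA.diag_nonneg (i := 0))
  have h11 := Complex.nonneg_iff.1 (hA.diag_nonneg (i := 1))
  have h10 : A 1 0 = conj (A 0 1) := by
    have := hA.1.apply 1 0
    rw [← this]; rfl
  have hdet := Complex.nonneg_iff.1 hA.det_nonneg
  rw [Matrix.det_fin_two] at hdet
  have hre : (A 0 0 * A 1 1 - A 0 1 * A 1 0).re = (A 0 0).re * (A 1 1).re - ‖A 0 1‖ ^ 2 := by
    rw [h10, Complex.mul_conj', Complex.sub_re, Complex.mul_re, ← Complex.ofReal_pow, Complex.ofReal_re,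
      ← h00.2, ← h11.2]
    ring
  refine ⟨h00.1, h11.1, h00.2.symm, h11.2.symm, h10, ?_⟩
  linarith [hdet.1, hre.symm.le, hre.le]

/-- For positive semidefinite 2×2 complex matrices `A, B`: `tr(AB)` is real and nonnegative. -/
theorem trace_mul_re_nonneg_fin_two (A B : Matrix (Fin 2) (Fin 2) ℂ) (hA : A.PosSemidef) (hB : B.PosSemidef) :
    0 ≤ ((A * B).trace).re := by
  obtain ⟨a0, a1, _, _, ha10, hadet⟩ := psd_fin_two_entries A hA
  obtain ⟨b0, b1, _, _, hb10, hbdet⟩ := psd_fin_two_entries B hB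
  rw [Matrix.trace_fin_two, Matrix.mul_apply, Matrix.mul_apply, Fin.sum_univ_two, Fin.sum_univ_two,
    ha10, hb10]
  simp only [Complex.add_re, Complex.mul_re, Complex.conj_re, Complex.conj_im]
  -- 2 Re(A₀₁ conj B₀₁) ≥ -2 |A₀₁| |B₀₁| ≥ -(A₀₀B₀₀ + A₁₁B₁₁)
  have hcs : (A 0 1).re * (B 0 1).re + (A 0 1).im * (B 0 1).im ≥ -(‖A 0 1‖ * ‖B 0 1‖) := by
    have h := Complex.re_le_norm (A 0 1 * conj (B 0 1))
    have h2 := Complex.abs_re_le_norm (A 0 1 * conj (B 0 1))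
    rw [norm_mul, Complex.norm_conj] at h2
    have : (A 0 1 * conj (B 0 1)).re = (A 0 1).re * (B 0 1).re + (A 0 1).im * (B 0 1).im := by
      simp [Complex.mul_re]
    rw [this] at h2
    linarith [(abs_le.1 h2).1]
  have hprod : ‖A 0 1‖ * ‖B 0 1‖ ≤ ((A 0 0).re * (B 0 0).re + (A 1 1).re * (B 1 1).re) / 2 := by
    have hn : 0 ≤ ‖A 0 1‖ * ‖B 0 1‖ := by positivity
    have h4 : (‖A 0 1‖ * ‖B 0 1‖) ^ 2 ≤ ((A 0 0).re * (A 1 1).re) * ((B 0 0).re * (B 1 1).re) := by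
      rw [mul_pow]; exact mul_le_mul hadet hbdet (by positivity) (by positivity)
    nlinarith [sq_nonneg ((A 0 0).re * (B 0 0).re - (A 1 1).re * (B 1 1).re),
      mul_nonneg a0 (psd_fin_two_entries B hB).1, mul_nonneg a1 (psd_fin_two_entries B hB).2.1]
  have hdiag₀ : (A 0 0).im * (B 0 0).im = 0 := by rw [(psd_fin_two_entries A hA).2.2.1]; ring
  have hdiag₁ : (A 1 1).im * (B 1 1).im = 0 := by rw [(psd_fin_two_entries A hA).2.2.2.1]; ring
  nlinarith [hcs, hprod, hdiag₀, hdiag₁]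


/-- The real part of the determinant of a Hermitian-type 2×2 matrix in entries. -/
theorem det_re_fin_two (A : Matrix (Fin 2) (Fin 2) ℂ) (h10 : A 1 0 = conj (A 0 1))
    (h00 : (A 0 0).im = 0) (h11 : (A 1 1).im = 0) :
    (A.det).re = (A 0 0).re * (A 1 1).re - ‖A 0 1‖ ^ 2 := by
  rw [Matrix.det_fin_two, h10, Complex.mul_conj', Complex.sub_re, Complex.mul_re, ← Complex.ofReal_pow,
    Complex.ofReal_re, h00, h11]
  ring

/-- Determinant is monotone on positive semidefinite 2×2 matrices: `det B ≤ det (B + D)`. -/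
theorem det_mono_fin_two (B D : Matrix (Fin 2) (Fin 2) ℂ) (hB : B.PosSemidef) (hD : D.PosSemidef) :
    (B.det).re ≤ ((B + D).det).re := by
  obtain ⟨b0, b1, bi0, bi1, hb10, hbdet⟩ := psd_fin_two_entries B hB
  obtain ⟨d0, d1, di0, di1, hd10, hddet⟩ := psd_fin_two_entries D hD
  have hs10 : (B + D) 1 0 = conj ((B + D) 0 1) := by simp [hb10, hd10]
  rw [det_re_fin_two B hb10 bi0 bi1, det_re_fin_two (B + D) hs10 (by simp [bi0, di0]) (by simp [bi1, di1])]
  simp only [Matrix.add_apply, Complex.add_re]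
  -- ‖b₀₁ + d₀₁‖² ≤ ‖b₀₁‖² + ‖d₀₁‖² + 2‖b₀₁‖‖d₀₁‖ and 2‖b₀₁‖‖d₀₁‖ ≤ b₀ d₁ + b₁ d₀
  have h1 : ‖B 0 1 + D 0 1‖ ^ 2 ≤ (‖B 0 1‖ + ‖D 0 1‖) ^ 2 := by
    have := norm_add_le (B 0 1) (D 0 1)
    nlinarith [norm_nonneg (B 0 1 + D 0 1), norm_nonneg (B 0 1), norm_nonneg (D 0 1)]
  have h2 : 2 * (‖B 0 1‖ * ‖D 0 1‖) ≤ (B 0 0).re * (D 1 1).re + (B 1 1).re * (D 0 0).re := by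
    have h4 : (‖B 0 1‖ * ‖D 0 1‖) ^ 2 ≤ ((B 0 0).re * (D 1 1).re) * ((B 1 1).re * (D 0 0).re) := by
      rw [mul_pow]
      calc ‖B 0 1‖ ^ 2 * ‖D 0 1‖ ^ 2 ≤ ((B 0 0).re * (B 1 1).re) * ((D 0 0).re * (D 1 1).re) :=
            mul_le_mul hbdet hddet (by positivity) (by positivity)
        _ = ((B 0 0).re * (D 1 1).re) * ((B 1 1).re * (D 0 0).re) := by ring
    nlinarith [sq_nonneg ((B 0 0).re * (D 1 1).re - (B 1 1).re * (D 0 0).re),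
      mul_nonneg b0 d1, mul_nonneg b1 d0, norm_nonneg (B 0 1), norm_nonneg (D 0 1)]
  nlinarith [h1, h2, hddet, mul_nonneg d0 d1]

/-- **Hölder at the identity** for positive semidefinite 2×2 matrices:
`tr(AB) + 2 √(det A · det B) ≤ tr A · tr B`. -/
theorem holder_id_fin_two (A B : Matrix (Fin 2) (Fin 2) ℂ) (hA : A.PosSemidef) (hB : B.PosSemidef) :
    ((A * B).trace).re + 2 * Real.sqrt ((A.det).re * (B.det).re) ≤ (A.trace).re * (B.trace).re := by
  obtain ⟨a0, a1, ai0, ai1, ha10, hadet⟩ := psd_fin_two_entries A hA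
  obtain ⟨b0, b1, bi0, bi1, hb10, hbdet⟩ := psd_fin_two_entries B hB
  rw [det_re_fin_two A ha10 ai0 ai1, det_re_fin_two B hb10 bi0 bi1, Matrix.trace_fin_two,
    Matrix.trace_fin_two, Matrix.trace_fin_two, Matrix.mul_apply, Matrix.mul_apply, Fin.sum_univ_two,
    Fin.sum_univ_two, ha10, hb10]
  simp only [Complex.add_re, Complex.mul_re, Complex.conj_re, Complex.conj_im, ai0, ai1, bi0, bi1,
    mul_zero, sub_zero]
  set u := ‖A 0 1‖ with hu
  set v := ‖B 0 1‖ with hv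
  set x := (A 0 0).re; set y := (A 1 1).re; set p := (B 0 0).re; set q := (B 1 1).re
  -- Re-part of the cross term is bounded by u v
  have hcross : (A 0 1).re * (B 0 1).re + (A 0 1).im * (B 0 1).im ≤ u * v := by
    have h := Complex.re_le_norm (A 0 1 * conj (B 0 1))
    rw [norm_mul, Complex.norm_conj] at h
    have : (A 0 1 * conj (B 0 1)).re = (A 0 1).re * (B 0 1).re + (A 0 1).im * (B 0 1).im := by
      simp [Complex.mul_re]
    linarith [this]
  -- also the (0,1)·(1,0) pairing in tr(AB): A₀₁ B₁₀ + A₁₀ B₀₁ has real part 2 (Re A₀₁ Re B₀₁ + Im A₀₁ Im B₀₁)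
  -- √((xy − u²)(pq − v²)) ≤ √(xy)√(pq) − u v
  have hu0 : 0 ≤ u := norm_nonneg _
  have hv0 : 0 ≤ v := norm_nonneg _
  set abar := Real.sqrt (x * y) with habar
  set bbar := Real.sqrt (p * q) with hbbar
  have habar2 : abar ^ 2 = x * y := Real.sq_sqrt (mul_nonneg a0 a1)
  have hbbar2 : bbar ^ 2 = p * q := Real.sq_sqrt (mul_nonneg b0 b1)
  have hua : u ≤ abar := by
    rw [habar, ← Real.sqrt_sq hu0]; exact Real.sqrt_le_sqrt hadet
  have hvb : v ≤ bbar := by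
    rw [hbbar, ← Real.sqrt_sq hv0]; exact Real.sqrt_le_sqrt hbdet
  have hkey : Real.sqrt ((x * y - u ^ 2) * (p * q - v ^ 2)) ≤ abar * bbar - u * v := by
    have hnn : 0 ≤ abar * bbar - u * v := by nlinarith [mul_le_mul hua hvb hv0 (le_trans hu0 hua)]
    rw [← Real.sqrt_sq hnn]
    apply Real.sqrt_le_sqrt
    rw [← habar2, ← hbbar2]
    nlinarith [sq_nonneg (abar * v - u * bbar), mul_nonneg hu0 hv0,
      mul_nonneg (le_trans hu0 hua) (le_trans hv0 hvb)]
  -- AM–GM: 2 abar bbar ≤ x q + y p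
  have hamgm : 2 * (abar * bbar) ≤ x * q + y * p := by
    have h4 : (abar * bbar) ^ 2 = (x * q) * (y * p) := by rw [mul_pow, habar2, hbbar2]; ring
    nlinarith [sq_nonneg (x * q - y * p), mul_nonneg a0 b1, mul_nonneg a1 b0,
      mul_nonneg (Real.sqrt_nonneg (x * y)) (Real.sqrt_nonneg (p * q))]
  nlinarith [hkey, hamgm, hcross]

/-- **Hölder's inequality for 2×2 fidelity**, weighted form without inverses: for positive semidefinite
`A, B` and `P = E Eᴴ`: `det P · tr(AB) + 2 det P √(det A det B) ≤ tr(AP) · tr(B adj P)`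
(i.e. `F(A,B)² ≤ tr(AP) tr(BP⁻¹)`). -/
theorem holder_fin_two (A B E : Matrix (Fin 2) (Fin 2) ℂ) (hA : A.PosSemidef) (hB : B.PosSemidef) :
    ((E * Eᴴ).det).re * ((A * B).trace).re
        + 2 * ((E * Eᴴ).det).re * Real.sqrt ((A.det).re * (B.det).re)
      ≤ ((A * (E * Eᴴ)).trace).re * ((B * (E * Eᴴ).adjugate).trace).re := by
  set A' : Matrix (Fin 2) (Fin 2) ℂ := Eᴴ * A * E with hA'
  set B' : Matrix (Fin 2) (Fin 2) ℂ := E.adjugate * B * E.adjugateᴴ with hB'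
  have hA'psd : A'.PosSemidef := hA.conjTranspose_mul_mul_same E
  have hB'psd : B'.PosSemidef := by
    have := hB.mul_mul_conjTranspose_same E.adjugate
    simpa only [hB'] using this
  have h := holder_id_fin_two A' B' hA'psd hB'psd
  -- |det E|²
  set δ : ℝ := ‖E.det‖ ^ 2 with hδ
  have hdetP : ((E * Eᴴ).det).re = δ := by
    rw [Matrix.det_mul, Matrix.det_conjTranspose, Complex.star_def, Complex.mul_conj', ← Complex.ofReal_pow,
      Complex.ofReal_re]
  -- traces
  have htrA : A'.trace = (A * (E * Eᴴ)).trace := by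
    rw [hA', Matrix.trace_mul_cycle, ← Matrix.mul_assoc, Matrix.trace_mul_cycle, Matrix.mul_assoc]
  have hadjP : (E * Eᴴ).adjugate = E.adjugateᴴ * E.adjugate := by
    rw [Matrix.adjugate_mul_distrib, Matrix.adjugate_conjTranspose]
  have htrB : B'.trace = (B * (E * Eᴴ).adjugate).trace := by
    rw [hB', hadjP, Matrix.trace_mul_comm (E.adjugate * B) E.adjugateᴴ, ← Matrix.mul_assoc,
      Matrix.trace_mul_comm (E.adjugateᴴ * E.adjugate) B]
  have htrAB : (A' * B').trace = (δ : ℂ) * (A * B).trace := by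
    have e1 : A' * B' = Eᴴ * (A * (E * E.adjugate) * B) * E.adjugateᴴ := by
      simp only [hA', hB', Matrix.mul_assoc]
    have e2 : A * (E.det • (1 : Matrix (Fin 2) (Fin 2) ℂ)) * B = E.det • (A * B) := by
      rw [Matrix.mul_smul, Matrix.mul_one, Matrix.smul_mul]
    have e3 : E.adjugateᴴ * Eᴴ = star E.det • (1 : Matrix (Fin 2) (Fin 2) ℂ) := by
      rw [← Matrix.conjTranspose_mul, Matrix.mul_adjugate, Matrix.conjTranspose_smul, Matrix.conjTranspose_one]
    rw [e1, Matrix.mul_adjugate, e2, Matrix.trace_mul_cycle, e3, Matrix.smul_mul, Matrix.one_mul, smul_smul,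
      Matrix.trace_smul, smul_eq_mul, hδ, Complex.star_def, Complex.ofReal_pow, ← Complex.mul_conj', mul_comm (E.det)]
  have hdetA : A'.det = (δ : ℂ) * A.det := by
    rw [hA', Matrix.det_mul, Matrix.det_mul, Matrix.det_conjTranspose, Complex.star_def, hδ,
      Complex.ofReal_pow, ← Complex.mul_conj']; ring
  have hdetB : B'.det = (δ : ℂ) * B.det := by
    rw [hB', Matrix.det_mul, Matrix.det_mul, Matrix.det_conjTranspose, Matrix.det_adjugate,
      Complex.star_def, hδ, Complex.ofReal_pow, ← Complex.mul_conj']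
    simp only [Fintype.card_fin]
    ring
  rw [htrA, htrB, htrAB, hdetA, hdetB] at h
  simp only [Complex.re_ofReal_mul] at h
  have hδ0 : 0 ≤ δ := by positivity
  have hsq : Real.sqrt (δ * (A.det).re * (δ * (B.det).re)) = δ * Real.sqrt ((A.det).re * (B.det).re) := by
    have : δ * (A.det).re * (δ * (B.det).re) = δ ^ 2 * ((A.det).re * (B.det).re) := by ring
    rw [this, Real.sqrt_mul (by positivity), Real.sqrt_sq hδ0]
  rw [hsq] at h
  rw [hdetP]
  linarith


end Summit.MatrixMultiplication.MatrixMultiplication.Theorems.RankTwoAdditivity
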